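import Summits.BirchSwinnertonDyer.BirchSwinnertonDyer.Theorems.AlignedTransportAtTwoMainConjectureTransportAlignedAtTwoKilfordCopyCrossLevelTools
import HarnessLib

/-!
# Crux C1 `MainConjectureTransportAlignedAtTwo` (stmt-BirchSwinnertonDyer-22296), line `birth`, residual (R2) `stub_lamLawKilford`, UNEQUAL conductors:
# THE INTERMEDIATE-LEVEL REDUCTION FOR A SQUAREFREE RATIO `N₂ = N₁·m`, `m = ∏_{q∈Q} q` — iterated absorption through the old line
# `F_Q = ∑_{d∣m} d·f₁(d·)` (width seat att-p3 g18; `--supports 22296`; sequel of `…KilfordCopyCrossLevel`, which is the case `#Q = 1`)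

THEOREMS ONLY (no `def`, no `sorry`, no named fact). Pure period bookkeeping (`…KilfordCopyCrossLevelTools`, att-p1 g9's depleted period formula); no
Galois input, no alignment; BSD is not proved by this; C1 is not closed by this; the cross-level input of (R2) is REDUCED (for the conductor shape
`N(W₂) = N(W₁)·m`, `m` squarefree and prime to `N(W₁)` — every pair of SEMISTABLE-at-`m` type with `E₁` good and `E₂` multiplicative at the primes of `m`)
to «same half-kernel at level `N₂` of `(c₁·y(F_Q), c₂·y(f₂))`», `F_Q ∈ S₂(Γ₀(N₂))` the `m`-old line of `f₁` (mod `2`: `f₁ | ∏_{q∣m}(1 + V_q)`, the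
`U_q ≡ 1` line at every `q ∣ m`) — this file proves the ENGINE of that reduction (the iterated absorption, §2); the pair packaging is its sequel.
att-p5 g18's fourth engine is set to test exactly these composite ratios (`δ = Σ_{d∣m} α_d^*`).

* §1 `act_prod_oldLines` (`(∏_{q∈Q}([1]+[q]))·ψ` and its integrality), `swap_mod_two` (one absorption step on an arbitrary symbol function).
* §2 **`oldLines_absorb`** — induction on `Q`: for `f` good at every `q ∈ Q` with `a_q(f)` EVEN, `c·∏ℓ²·{∞, γ∞}_g ≡ c·(Q̄·Ψ_Q)(γ∞) (mod 2Λ)` where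
  `Ψ_Q = (∏_{q∈Q}([1]+[q]))·{∞,·}_f` (= `{∞,·}_{F_Q}`) and `Q̄` is ANY integer operator congruent to `f`'s Euler data off `Q` and «multiplicative»
  (`B'` odd, `E' = 0`) on `Q`.
* (sequel, not here) the packaging for pairs `N₂ = N₁·m`: `{∞,s}_{F_Q} = Ψ_Q(s)` for the `m`-old line `F_Q = ∑_{d∣m} d·ι_d f₁`, one common cycle
  (`…Tools.exists_mem_periodHomology_apply_eq_act`), and the `f₂`-side congruence — exactly as in `…KilfordCopyCrossLevel.sameKernel_depleted_of_sameKernel_oldLine`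
  with `oldLines_absorb` in place of `oldLine_absorb`.

References: Greenberg–Vatsal 2000 §3 [GreenbergVatsal2000]; Emerton–Pollack–Weston 2006 §3 (3.4)–(3.5) [EmertonPollackWeston2006]; Cremona 1997 §2.4,
§2.10 [CremonaAlgorithms1997]; Diamond–Shurman §5.7 [DiamondShurman2005].
-/

noncomputable section

-- justification: the `Summit.BirchSwinnertonDyer.BirchSwinnertonDyer.…` path repeats a component (route-file convention)
set_option linter.dupNamespace false
set_option autoImplicit false

open scoped MatrixGroups ModularForm Classical

open CongruenceSubgroup Complex
open Literature.NumberTheory.EllipticCurves Literature.NumberTheory.EllipticCurves.ModularForms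
open Summit.BirchSwinnertonDyer.BirchSwinnertonDyer.Theorems.ThetaLayerLambdaCongruenceAtTwo
open Summit.BirchSwinnertonDyer.BirchSwinnertonDyer.Theorems.AlignedTransportAtTwoDepletedPeriodFormula
open Summit.BirchSwinnertonDyer.BirchSwinnertonDyer.Theorems.MazurTateCongruenceAtTwoR.DepletedLattice (modularSymbol_iota)
open Summit.BirchSwinnertonDyer.BirchSwinnertonDyer.Theorems.AlignedTransportAtTwoKilfordCopyCrossLevelTools

namespace Summit.BirchSwinnertonDyer.BirchSwinnertonDyer.Theorems.AlignedTransportAtTwoKilfordCopyCrossLevelSquarefree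

/-! ## §1 The old-lines operator `∏_{q∈Q}([1]+[q])` and one absorption step -/

/-- One old-line factor: `(([1] + [q])·Ψ)(x) = Ψ(x) + Ψ(q x)`. [folklore] -/
theorem act_oldLineFactor (Ψ : ℚ → ℂ) (q : ℕ) (x : ℚ) :
    ((MonoidAlgebra.single 1 (1 : ℂ) + MonoidAlgebra.single q (1 : ℂ) : MonoidAlgebra ℂ ℕ).coeff.sum fun m a ↦ a * Ψ ((m : ℚ) * x)) =
      Ψ x + Ψ ((q : ℚ) * x) := by
  rw [act_add, act_single, act_single, Nat.cast_one, one_mul, one_mul, one_mul]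

/-- Inserting a prime into the old-lines operator: `(∏_{insert q Q}([1]+[q']))·ψ (x) = (∏_Q …·ψ)(x) + (∏_Q …·ψ)(q x)`. [folklore] -/
theorem act_prod_oldLines_insert (ψ : ℚ → ℂ) {q : ℕ} {Q : Finset ℕ} (hq : q ∉ Q) (x : ℚ) :
    ((∏ q' ∈ insert q Q, (MonoidAlgebra.single 1 (1 : ℂ) + MonoidAlgebra.single q' (1 : ℂ)) : MonoidAlgebra ℂ ℕ).coeff.sum
        fun m a ↦ a * ψ ((m : ℚ) * x)) =
      ((∏ q' ∈ Q, (MonoidAlgebra.single 1 (1 : ℂ) + MonoidAlgebra.single q' (1 : ℂ)) : MonoidAlgebra ℂ ℕ).coeff.sum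
          fun m a ↦ a * ψ ((m : ℚ) * x)) +
        ((∏ q' ∈ Q, (MonoidAlgebra.single 1 (1 : ℂ) + MonoidAlgebra.single q' (1 : ℂ)) : MonoidAlgebra ℂ ℕ).coeff.sum
          fun m a ↦ a * ψ ((m : ℚ) * ((q : ℚ) * x))) := by
  rw [Finset.prod_insert hq, act_mul]
  exact act_oldLineFactor (fun s ↦ ((∏ q' ∈ Q, (MonoidAlgebra.single 1 (1 : ℂ) + MonoidAlgebra.single q' (1 : ℂ)) :
    MonoidAlgebra ℂ ℕ).coeff.sum fun m a ↦ a * ψ ((m : ℚ) * s))) q x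

/-- **Integrality of the old-lines operator**: if `c·ψ(d·x) ∈ Λ` for every `d ∣ ∏_{q∈Q} q` then `c·((∏_{q∈Q}([1]+[q]))·ψ)(x) ∈ Λ`. [folklore] -/
theorem mul_act_prod_oldLines_mem (Λ : AddSubgroup ℂ) (ψ : ℚ → ℂ) (c : ℂ) (Q : Finset ℕ) :
    ∀ (x : ℚ), (∀ d : ℕ, d ∣ ∏ q ∈ Q, q → c * ψ ((d : ℚ) * x) ∈ Λ) →
      c * (((∏ q ∈ Q, (MonoidAlgebra.single 1 (1 : ℂ) + MonoidAlgebra.single q (1 : ℂ)) : MonoidAlgebra ℂ ℕ).coeff.sum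
        fun m a ↦ a * ψ ((m : ℚ) * x))) ∈ Λ := by
  classical
  induction Q using Finset.induction_on with
  | empty =>
    intro x hΛ
    rw [Finset.prod_empty, MonoidAlgebra.one_def, act_single, one_mul]
    simpa only [Finset.prod_empty, Nat.cast_one] using hΛ 1 (by simp)
  | insert q Q hqQ ih =>
    intro x hΛ
    rw [act_prod_oldLines_insert ψ hqQ, mul_add]
    refine Λ.add_mem (ih x fun d hd ↦ hΛ d (by rw [Finset.prod_insert hqQ]; exact hd.mul_left q)) (ih _ fun d hd ↦ ?_)
    have h := hΛ (d * q) (by rw [Finset.prod_insert hqQ, mul_comm]; exact mul_dvd_mul_left q hd)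
    simpa only [Nat.cast_mul, mul_assoc] using h

/-- **One absorption step on an arbitrary symbol function** `Ψ`: with `Φ = (P·Ψ)`, `([1] + [q²])P·Ψ (r) ≡ ([1] + b[q])P·(Ψ + Ψ∘[q]) (r) (mod 2Λ/c)` for `b`
ODD, provided `c·Φ(q r), c·Φ(q² r) ∈ Λ` — because `Φ(r) + Φ(q²r)` and `Φ(r) + (1+b)Φ(qr) + bΦ(q²r)` differ by even multiples. [folklore] -/
theorem swap_mod_two (Λ : AddSubgroup ℂ) (c : ℂ) (P : MonoidAlgebra ℂ ℕ) (Ψ : ℚ → ℂ) (q : ℕ) (b : ℤ) (hb : Odd b) (r : ℚ)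
    (hΦ₁ : c * (P.coeff.sum fun m a ↦ a * Ψ ((m : ℚ) * ((q : ℚ) * r))) ∈ Λ)
    (hΦ₂ : c * (P.coeff.sum fun m a ↦ a * Ψ ((m : ℚ) * ((q : ℚ) * ((q : ℚ) * r)))) ∈ Λ) :
    ∃ z ∈ Λ, c * (((MonoidAlgebra.single 1 (1 : ℂ) + MonoidAlgebra.single q (0 : ℂ) + MonoidAlgebra.single (q ^ 2) (1 : ℂ)) * P :
        MonoidAlgebra ℂ ℕ).coeff.sum fun m a ↦ a * Ψ ((m : ℚ) * r)) =
      c * (((MonoidAlgebra.single 1 (1 : ℂ) + MonoidAlgebra.single q ((b : ℤ) : ℂ) + MonoidAlgebra.single (q ^ 2) (0 : ℂ)) * P :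
        MonoidAlgebra ℂ ℕ).coeff.sum fun m a ↦ a * (Ψ ((m : ℚ) * r) + Ψ ((q : ℚ) * ((m : ℚ) * r)))) + 2 * z := by
  have hqq : (((q ^ 2 : ℕ) : ℚ) * r) = (q : ℚ) * ((q : ℚ) * r) := by push_cast; ring
  obtain ⟨t, ht⟩ := hb
  refine ⟨-(((t : ℂ) + 1) * (c * (P.coeff.sum fun m a ↦ a * Ψ ((m : ℚ) * ((q : ℚ) * r))))) -
      (t : ℂ) * (c * (P.coeff.sum fun m a ↦ a * Ψ ((m : ℚ) * ((q : ℚ) * ((q : ℚ) * r))))), ?_, ?_⟩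
  · refine Λ.sub_mem (Λ.neg_mem ?_) ?_
    · rw [show ((t : ℂ) + 1) = ((t + 1 : ℤ) : ℂ) by push_cast; ring, ← zsmul_eq_mul]; exact Λ.zsmul_mem hΦ₁ _
    · rw [← zsmul_eq_mul]; exact Λ.zsmul_mem hΦ₂ _
  · rw [act_oldLine, act_factor_mul, act_factor_mul, act_factor_mul]
    simp only [hqq, zero_mul, add_zero, one_mul]
    rw [ht]; push_cast; ring

/-! ## §2 Iterated absorption through the `m`-old line, `m = ∏_{q∈Q} q` -/

/-- **Iterated absorption.** `f ∈ S₂(Γ₀(N))` a Hecke eigenform with integer coefficients `A`; `S` a set of odd primes and `Q ⊆ S` with `q ∤ N` and `a_q(f)`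
EVEN for `q ∈ Q`; `g` the `S`-depleted form at a level `N'` with `N·(∏_{q∈Q}q)·∏_{ℓ∈S}ℓ² ∣ N'`; `Λ ⊇ c·Λ_f`; integer data `(B', E')` congruent to
`f`'s Euler data `(-a_ℓ, 𝟙_{ℓ∤N})` on `S ∖ Q` and «multiplicative» (`B'_q` odd, `E'_q = 0`) on `Q`. Then for every cusp `γ∞`, `γ ∈ Γ₀(N')`:
`c·∏ℓ²·{∞, γ∞}_g ≡ c·(∏_{ℓ∈S}([1] + B'_ℓ[ℓ] + E'_ℓ[ℓ²]) · (∏_{q∈Q}([1]+[q])) · {∞,·}_f)(γ∞) (mod 2Λ)`. Induction on `Q` by `swap_mod_two`.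
[cite: GreenbergVatsal2000, §3] [cite: EmertonPollackWeston2006, §3 (3.4)–(3.5)] [cite: CremonaAlgorithms1997, §2.4] -/
theorem oldLines_absorb {N : ℕ} [NeZero N] (f : CuspForm (Gamma0 N) 2) (A : ℕ → ℤ) (hA : ∀ n, cuspCoeff f n = A n)
    (hT : ∀ (p : ℕ) (hp : p.Prime), (haveI : NeZero p := ⟨hp.ne_zero⟩; heckeT (Gamma0 N) 2 p f) = cuspCoeff f p • f)
    (S : Finset ℕ) (hS : ∀ ℓ ∈ S, ℓ.Prime) (hSodd : ∀ ℓ ∈ S, Odd ℓ)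
    (N' : ℕ) [NeZero N'] (Λ : AddSubgroup ℂ) (c : ℂ) (hc : ∀ z ∈ periodLattice f, c * z ∈ Λ)
    (g : CuspForm (Gamma0 N') 2) (hg : ∀ n, cuspCoeff g n = if ∃ ℓ ∈ S, ℓ ∣ n then 0 else cuspCoeff f n)
    (γ : Gamma0 N') (hγ : (γ : SL(2, ℤ)) 1 0 ≠ 0) (Q : Finset ℕ) :
    Q ⊆ S → (∀ q ∈ Q, ¬ q ∣ N) → (∀ q ∈ Q, Even (A q)) → N * (∏ q ∈ Q, q) * ∏ ℓ ∈ S, ℓ ^ 2 ∣ N' →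
    ∀ (B' E' : ℕ → ℤ), (∀ ℓ ∈ S, ℓ ∉ Q → (2 : ℤ) ∣ -A ℓ - B' ℓ) → (∀ ℓ ∈ S, ℓ ∉ Q → (2 : ℤ) ∣ (if ℓ ∣ N then 0 else 1) - E' ℓ) →
    (∀ q ∈ Q, Odd (B' q)) → (∀ q ∈ Q, E' q = 0) →
    ∃ z ∈ Λ, c * (((∏ ℓ ∈ S, ℓ ^ 2 : ℕ) : ℂ) *
        modularSymbol g ((((γ : SL(2, ℤ)) 0 0 : ℚ) / ((γ : SL(2, ℤ)) 1 0 : ℚ)))) =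
      c * ((∏ ℓ ∈ S, (MonoidAlgebra.single 1 (1 : ℂ) + MonoidAlgebra.single ℓ ((B' ℓ : ℤ) : ℂ) +
          MonoidAlgebra.single (ℓ ^ 2) ((E' ℓ : ℤ) : ℂ)) : MonoidAlgebra ℂ ℕ).coeff.sum fun m a ↦ a *
            (((∏ q ∈ Q, (MonoidAlgebra.single 1 (1 : ℂ) + MonoidAlgebra.single q (1 : ℂ)) : MonoidAlgebra ℂ ℕ).coeff.sum
              fun m' a' ↦ a' * modularSymbol f ((m' : ℚ) * ((m : ℚ) * ((((γ : SL(2, ℤ)) 0 0 : ℚ) / ((γ : SL(2, ℤ)) 1 0 : ℚ)))))))) + 2 * z := by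
  classical
  set r : ℚ := (((γ : SL(2, ℤ)) 0 0 : ℚ) / ((γ : SL(2, ℤ)) 1 0 : ℚ)) with hr
  have hM0 : (∏ ℓ ∈ S, ℓ ^ 2) ≠ 0 := Finset.prod_ne_zero_iff.mpr fun ℓ hℓ ↦ pow_ne_zero 2 (hS ℓ hℓ).ne_zero
  have hℓ0 : ∀ ℓ ∈ S, (ℓ : ℂ) ≠ 0 := fun ℓ hℓ ↦ by exact_mod_cast (hS ℓ hℓ).ne_zero
  -- `c·{∞, m' r}_f ∈ Λ` for `m' ∣ (∏Q)·∏ℓ²` once `N·(∏Q)·∏ℓ² ∣ N'`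
  have hΛ : ∀ (D : ℕ), N * D ∣ N' → ∀ m : ℕ, m ∣ D → c * modularSymbol f ((m : ℚ) * r) ∈ Λ := by
    intro D hD m hm
    have hm0 : m ≠ 0 := by
      rintro rfl
      rw [zero_dvd_iff] at hm; subst hm
      rw [mul_zero, zero_dvd_iff] at hD; exact (NeZero.ne N') hD
    obtain ⟨δ, hδ, hδr⟩ := exists_gamma0_dilate_cusp hm0 ((mul_dvd_mul_left N hm).trans hD) γ hγ
    have h : cuspSymbol f δ = modularSymbol f ((m : ℚ) * r) := by rw [cuspSymbol, if_neg hδ, hδr]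
    rw [← h]
    exact hc _ (cuspSymbol_mem_periodLattice f δ)
  induction Q using Finset.induction_on with
  | empty =>
    intro _ _ _ hN' B' E' hB' hE' _ _
    rw [Finset.prod_empty, mul_one] at hN'
    have hdep := modularSymbol_depleted_eq_act_of_dvd f hT S hS N' hN' g hg r
    have hu : ∀ ℓ ∈ S, (ℓ : ℂ) * (-(cuspCoeff f ℓ) * (ℓ : ℂ)⁻¹) = ((-A ℓ : ℤ) : ℂ) := fun ℓ hℓ ↦ by
      rw [hA, mul_comm, mul_assoc, inv_mul_cancel₀ (hℓ0 ℓ hℓ), mul_one, Int.cast_neg]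
    have hv : ∀ ℓ ∈ S, (ℓ : ℂ) * (if ℓ ∣ N then 0 else (ℓ : ℂ)⁻¹) = ((if ℓ ∣ N then 0 else 1 : ℤ) : ℂ) := fun ℓ hℓ ↦ by
      split_ifs <;> simp [mul_inv_cancel₀ (hℓ0 ℓ hℓ)]
    obtain ⟨z, hz, h⟩ := mul_act_prod_congr_mod_two Λ (modularSymbol f) c
      (fun ℓ ↦ -(cuspCoeff f ℓ) * (ℓ : ℂ)⁻¹) (fun ℓ ↦ if ℓ ∣ N then 0 else (ℓ : ℂ)⁻¹) (fun ℓ ↦ -A ℓ) (fun ℓ ↦ if ℓ ∣ N then 0 else 1)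
      B' E' S hSodd hu hv (fun ℓ hℓ ↦ hB' ℓ hℓ (Finset.notMem_empty ℓ)) (fun ℓ hℓ ↦ hE' ℓ hℓ (Finset.notMem_empty ℓ)) r
      (hΛ _ hN')
    refine ⟨z, hz, ?_⟩
    rw [hdep]
    simp only [Finset.prod_empty, MonoidAlgebra.one_def, act_single, Nat.cast_one, one_mul]
    linear_combination h
  | insert q Q hqQ ih =>
    intro hQS hQN hQA hN' B' E' hB' hE' hBodd hE0
    have hq : q ∈ S := hQS (Finset.mem_insert_self q Q)
    have hQS' : Q ⊆ S := fun x hx ↦ hQS (Finset.mem_insert_of_mem hx)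
    -- induction hypothesis with the data `(0, 1)` at `q`
    have hN'' : N * (∏ q' ∈ Q, q') * ∏ ℓ ∈ S, ℓ ^ 2 ∣ N' := by
      refine Dvd.dvd.trans ?_ hN'
      rw [Finset.prod_insert hqQ]
      exact ⟨q, by ring⟩
    obtain ⟨z₀, hz₀, h₀⟩ := ih hQS' (fun q' hq' ↦ hQN q' (Finset.mem_insert_of_mem hq')) (fun q' hq' ↦ hQA q' (Finset.mem_insert_of_mem hq'))
      hN'' (fun ℓ ↦ if ℓ = q then 0 else B' ℓ) (fun ℓ ↦ if ℓ = q then 1 else E' ℓ)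
      (fun ℓ hℓ hℓQ ↦ by
        by_cases hℓq : ℓ = q
        · subst hℓq; rw [if_pos rfl, sub_zero]; exact (even_neg.mpr (hQA ℓ (Finset.mem_insert_self ℓ Q))).two_dvd
        · rw [if_neg hℓq]; exact hB' ℓ hℓ (fun h ↦ (Finset.mem_insert.mp h).elim hℓq hℓQ))
      (fun ℓ hℓ hℓQ ↦ by
        by_cases hℓq : ℓ = q
        · subst hℓq; rw [if_neg (hQN ℓ (Finset.mem_insert_self ℓ Q)), if_pos rfl, sub_self]; exact dvd_zero 2
        · rw [if_neg hℓq]; exact hE' ℓ hℓ (fun h ↦ (Finset.mem_insert.mp h).elim hℓq hℓQ))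
      (fun q' hq' ↦ by rw [if_neg (fun h ↦ hqQ (by rw [← h]; exact hq'))]; exact hBodd q' (Finset.mem_insert_of_mem hq'))
      (fun q' hq' ↦ by rw [if_neg (fun h ↦ hqQ (by rw [← h]; exact hq'))]; exact hE0 q' (Finset.mem_insert_of_mem hq'))
    -- split both operators at `q`
    set P : MonoidAlgebra ℂ ℕ := ∏ ℓ ∈ S.erase q, (MonoidAlgebra.single 1 (1 : ℂ) + MonoidAlgebra.single ℓ ((B' ℓ : ℤ) : ℂ) +
      MonoidAlgebra.single (ℓ ^ 2) ((E' ℓ : ℤ) : ℂ)) with hP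
    have hred₀ : (∏ ℓ ∈ S, (MonoidAlgebra.single 1 (1 : ℂ) + MonoidAlgebra.single ℓ (((if ℓ = q then 0 else B' ℓ : ℤ)) : ℂ) +
        MonoidAlgebra.single (ℓ ^ 2) (((if ℓ = q then 1 else E' ℓ : ℤ)) : ℂ)) : MonoidAlgebra ℂ ℕ) =
        (MonoidAlgebra.single 1 (1 : ℂ) + MonoidAlgebra.single q (0 : ℂ) + MonoidAlgebra.single (q ^ 2) (1 : ℂ)) * P := by
      rw [← Finset.mul_prod_erase S _ hq, if_pos rfl, if_pos rfl, Int.cast_zero, Int.cast_one, hP]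
      congr 1
      refine Finset.prod_congr rfl fun ℓ hℓ ↦ ?_
      rw [if_neg (Finset.ne_of_mem_erase hℓ), if_neg (Finset.ne_of_mem_erase hℓ)]
    have hred : (∏ ℓ ∈ S, (MonoidAlgebra.single 1 (1 : ℂ) + MonoidAlgebra.single ℓ ((B' ℓ : ℤ) : ℂ) +
        MonoidAlgebra.single (ℓ ^ 2) ((E' ℓ : ℤ) : ℂ)) : MonoidAlgebra ℂ ℕ) =
        (MonoidAlgebra.single 1 (1 : ℂ) + MonoidAlgebra.single q ((B' q : ℤ) : ℂ) + MonoidAlgebra.single (q ^ 2) (0 : ℂ)) * P := by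
      rw [← Finset.mul_prod_erase S _ hq, hE0 q (Finset.mem_insert_self q Q), Int.cast_zero, hP]
    -- the symbol function at stage `Q`
    set Ψ : ℚ → ℂ := (fun s ↦ ((∏ q' ∈ Q, (MonoidAlgebra.single 1 (1 : ℂ) + MonoidAlgebra.single q' (1 : ℂ)) : MonoidAlgebra ℂ ℕ).coeff.sum
      fun m' a' ↦ a' * modularSymbol f ((m' : ℚ) * s))) with hΨ
    -- integrality of `c·(P·Ψ)(q r)` and `c·(P·Ψ)(q² r)`
    have hMq : q ^ 2 * ∏ ℓ ∈ S.erase q, ℓ ^ 2 = ∏ ℓ ∈ S, ℓ ^ 2 := Finset.mul_prod_erase S (fun ℓ ↦ ℓ ^ 2) hq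
    have hΨint : ∀ (j : ℕ), j ≤ 2 → ∀ m : ℕ, m ∣ ∏ ℓ ∈ S.erase q, ℓ ^ 2 → c * Ψ ((m : ℚ) * (((q ^ j : ℕ) : ℚ) * r)) ∈ Λ := by
      intro j hj m hm
      refine mul_act_prod_oldLines_mem Λ (modularSymbol f) c Q _ fun d hd ↦ ?_
      have h := hΛ ((∏ q' ∈ insert q Q, q') * ∏ ℓ ∈ S, ℓ ^ 2) (by rw [← mul_assoc]; exact hN') (d * (m * q ^ j)) (by
        rw [Finset.prod_insert hqQ, ← hMq, show q * (∏ x ∈ Q, x) * (q ^ 2 * ∏ ℓ ∈ S.erase q, ℓ ^ 2) =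
          (∏ x ∈ Q, x) * ((∏ ℓ ∈ S.erase q, ℓ ^ 2) * (q ^ 2 * q)) by ring]
        exact mul_dvd_mul hd (mul_dvd_mul hm ((pow_dvd_pow q hj).trans (Dvd.intro q rfl))))
      simpa only [Nat.cast_mul, mul_assoc] using h
    have hΦ₁ : c * (P.coeff.sum fun m a ↦ a * Ψ ((m : ℚ) * ((q : ℚ) * r))) ∈ Λ :=
      mul_act_prod_int_mem Λ Ψ c B' E' (S.erase q) _ (by simpa only [pow_one] using hΨint 1 (by norm_num))
    have hΦ₂ : c * (P.coeff.sum fun m a ↦ a * Ψ ((m : ℚ) * ((q : ℚ) * ((q : ℚ) * r)))) ∈ Λ := by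
      have hqq : (((q ^ 2 : ℕ) : ℚ) * r) = (q : ℚ) * ((q : ℚ) * r) := by push_cast; ring
      simpa only [hqq] using mul_act_prod_int_mem Λ Ψ c B' E' (S.erase q) _ (hΨint 2 le_rfl)
    obtain ⟨z₁, hz₁, h₁⟩ := swap_mod_two Λ c P Ψ q (B' q) (hBodd q (Finset.mem_insert_self q Q)) r hΦ₁ hΦ₂
    refine ⟨z₀ + z₁, Λ.add_mem hz₀ hz₁, ?_⟩
    rw [hred₀] at h₀
    rw [hred]
    simp only [act_prod_oldLines_insert (modularSymbol f) hqQ]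
    rw [hΨ] at h₁
    linear_combination h₀ + h₁

end Summit.BirchSwinnertonDyer.BirchSwinnertonDyer.Theorems.AlignedTransportAtTwoKilfordCopyCrossLevelSquarefree

end
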